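import Mathlib
import Summits.MatrixMultiplication.Statement
import Summits.MatrixMultiplication.MatrixMultiplication.Theorems.GraphEquationsSystems
import Summits.MatrixMultiplication.MatrixMultiplication.Theorems.GraphEquationsCostRank
import Summits.MatrixMultiplication.MatrixMultiplication.Theorems.GraphEquationsInitialForms
import Summits.MatrixMultiplication.MatrixMultiplication.Theorems.GraphEquationsPureForms
import Summits.MatrixMultiplication.MatrixMultiplication.Theorems.GraphEquationsPureFormsNec

/-!
# The squared-generator witness: pure isolated / initial-form nondegenerate, nowhere reduced (`GraphEquations`, kernel M10)

Decomp-mm node «GraphEquations» (lens 5); attacked leaf `MultiplicityReduction` (`H_mult`).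
Target of the node, VERBATIM: `_root_.MatrixMultiplication`.  Critic SHARPEN s1 (STATUS
2026-08-31T05:21:50Z): make the per-system strictness `PureIsolated K ⊋ GenericallyReduced` a
LEMMA BY EXAMPLE.

`sqSystem` is the three-gate equation system for `W_1 = {c = ab} ⊂ ℂ³` with the single test
`(c − ab)²`.  Proved: it is CORRECT (`sqSystem_correct`), NOWHERE REDUCED on the graph
(`sqSystem_not_reducedAt`, `sqSystem_not_genericallyReduced`: its `C`-Jacobian `2(c − ab)` vanishes
on `W_1`), yet PURE ISOLATED of order `4` at `0` (`sqSystem_pureIsolatedAt_four`: the test is its own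
weight-`4` component, `= P(f)` with `P = F²`, fibre `{F² = 0} = {0}`) and INITIAL-FORM NONDEGENERATE
of order `4` at `0` (`sqSystem_initNondegAt_four`: gradient `2γ`, rank `1` at `γ = 1`).  Hence
`exists_correct_pureIsolated_not_reduced` / `exists_correct_initNondeg_not_reduced`: the per-system
hypotheses of the line «initial-form rank» are STRICTLY more permissive than generic reducedness.
No `sorry`.
-/

set_option linter.dupNamespace false

noncomputable section

open scoped BigOperators

namespace Summit.MatrixMultiplication.MatrixMultiplication.Theorems.GraphEquations

open MvPolynomial
open Literature.Computability.AlgebraicComplexity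
open Literature.Computability.AlgebraicComplexity.ArithCircuit

/-! ## The system `{(c − ab)²}` for `W_1` -/

/-- The coordinate `a` of `ℂ³ = ℂ^{3·1²}`. -/
abbrev va : GraphVars 1 := Sum.inl (Sum.inl (0, 0))
/-- The coordinate `b`. -/
abbrev vb : GraphVars 1 := Sum.inl (Sum.inr (0, 0))
/-- The coordinate `c`. -/
abbrev vc : GraphVars 1 := Sum.inr (0, 0)

/-- The three-gate system: `g₀ = a·b`, `g₁ = c − g₀`, `g₂ = g₁·g₁`; test `g₂ = (c − ab)²`. -/
def sqSystem : EqSystem 1 where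
  circuit :=
    { gates := [.prod [.var va, .var vb],
                .sum [(1, .var vc), (-1, .gate 0)],
                .prod [.gate 1, .gate 1]],
      output := .gate 2 }
  tests := [2]

/-- The generator of `𝕀(W_1)`: `f = c − ab`. -/
theorem generator_one : generator 1 (0, 0) = (X vc - X va * X vb : MvPolynomial (GraphVars 1) ℂ) := by
  simp [generator]

/-- The test polynomial is `(c − ab)²`. -/
theorem sqSystem_testPoly : sqSystem.testPoly 2 = (generator 1 (0, 0)) ^ 2 := by
  rw [generator_one]
  simp [EqSystem.testPoly, sqSystem, gateValues, Gate.eval, Operand.eval, List.foldl]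
  ring

/-- The test list is `[2]`. -/
theorem sqSystem_tests : sqSystem.tests = [2] := rfl

/-- Fan-in two. -/
theorem sqSystem_isFanInTwo : sqSystem.circuit.IsFanInTwo := by
  intro g hg
  simp only [sqSystem, List.mem_cons, List.not_mem_nil, or_false] at hg
  rcases hg with rfl | rfl | rfl <;> simp [Gate.fanIn, Gate.args]

/-- `f(x) = 0 ↔ x ∈ W_1`. -/
theorem eval_generator_one_eq_zero_iff (x : GraphVars 1 → ℂ) :
    eval x (generator 1 (0, 0)) = 0 ↔ x ∈ mmGraph 1 := by
  rw [generator_one]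
  simp only [map_sub, map_mul, eval_X, mmGraph, Set.mem_setOf_eq, Fin.forall_fin_one,
    Fin.sum_univ_one, Fin.isValue]
  exact sub_eq_zero

/-- **Correct.** -/
theorem sqSystem_correct : sqSystem.Correct := by
  refine ⟨sqSystem_isFanInTwo, ?_⟩
  ext x
  simp only [EqSystem.zeroSet, sqSystem_tests, List.mem_singleton, forall_eq, sqSystem_testPoly,
    map_pow, Set.mem_setOf_eq]
  rw [pow_eq_zero_iff two_ne_zero]
  exact eval_generator_one_eq_zero_iff x

/-- Cost `3`. -/
theorem sqSystem_cost : sqSystem.cost = 3 := rfl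

/-- The `C`-Jacobian vanishes identically on the graph. -/
theorem sqSystem_jacobianC_eq_zero {x : GraphVars 1 → ℂ} (hx : x ∈ mmGraph 1) :
    sqSystem.jacobianC x = 0 := by
  ext s q
  have hs : sqSystem.tests.get s = 2 := by
    obtain ⟨i, hi⟩ := s
    have hi' : i < 1 := hi
    interval_cases i; rfl
  have hq : q = (0, 0) := Subsingleton.elim _ _
  subst hq
  simp only [EqSystem.jacobianC, Matrix.of_apply, hs, sqSystem_testPoly, Matrix.zero_apply]
  rw [show (generator 1 (0, 0)) ^ 2 = generator 1 (0, 0) * generator 1 (0, 0) from sq _,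
    Derivation.leibniz]
  simp only [smul_eq_mul, map_add, map_mul, (eval_generator_one_eq_zero_iff x).mpr hx,
    zero_mul, add_zero]

/-- **Nowhere reduced on the graph.** -/
theorem sqSystem_not_reducedAt {x : GraphVars 1 → ℂ} (hx : x ∈ mmGraph 1) :
    ¬ sqSystem.ReducedAt x := by
  intro h
  rw [EqSystem.ReducedAt, sqSystem_jacobianC_eq_zero hx, Matrix.rank_zero] at h
  exact absurd h (by norm_num)

/-- Not generically reduced. -/
theorem sqSystem_not_genericallyReduced : ¬ sqSystem.GenericallyReduced := by
  rintro ⟨x, hx, h⟩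
  exact sqSystem_not_reducedAt hx h

/-- The shift at the origin is the identity substitution. -/
theorem shift_zero (n : ℕ) : shift (0 : GraphVars n → ℂ) = fun v => X v := by
  funext v
  rcases v with v | ⟨i, l⟩ <;> simp [shift]

/-- Shifting at the origin does nothing. -/
theorem bind₁_shift_zero {n : ℕ} (t : MvPolynomial (GraphVars n) ℂ) :
    bind₁ (shift (0 : GraphVars n → ℂ)) t = t := by
  rw [shift_zero]
  exact congrFun (congrArg DFunLike.coe (bind₁_X_left (σ := GraphVars n) (R := ℂ))) t

/-- `f²` is its own weight-`4` component. -/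
theorem weightedHomogeneousComponent_four_sq :
    weightedHomogeneousComponent (gw 1) 4 ((generator 1 (0, 0)) ^ 2) = (generator 1 (0, 0)) ^ 2 := by
  classical
  have h : IsWeightedHomogeneous (gw 1) ((generator 1 (0, 0)) ^ 2) 4 := by
    rw [sq]
    simpa using (isWeightedHomogeneous_generator (n := 1) (0, 0)).mul
      (isWeightedHomogeneous_generator (n := 1) (0, 0))
  rw [weightedHomogeneousComponent_of_mem h, if_pos rfl]

/-- The initial-form datum of the squared system at `0`: order `4`, `P = F²`. -/
theorem sqSystem_initialForm (o : Fin sqSystem.tests.length) :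
    weightedHomogeneousComponent (gw 1) 4
        (bind₁ (shift 0) (sqSystem.testPoly (sqSystem.tests.get o))) =
      aeval (generator 1) ((X (0, 0) : MvPolynomial (Fin 1 × Fin 1) ℂ) ^ 2) := by
  have hs : sqSystem.tests.get o = 2 := by
    obtain ⟨i, hi⟩ := o
    have hi' : i < 1 := hi
    interval_cases i; rfl
  rw [hs, bind₁_shift_zero, sqSystem_testPoly, weightedHomogeneousComponent_four_sq, map_pow,
    aeval_X]

/-- **Pure isolated of order `4` at the origin.** -/
theorem sqSystem_pureIsolatedAt_four : sqSystem.PureIsolatedAt 4 0 := by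
  refine ⟨fun _ => 4, fun _ => (X (0, 0)) ^ 2, fun _ => le_rfl, sqSystem_initialForm, ?_⟩
  intro F₀ hF
  have h0 := hF ⟨0, by simp [sqSystem]⟩
  simp only [map_pow, eval_X, Pi.zero_apply, ne_eq, OfNat.ofNat_ne_zero, not_false_eq_true,
    zero_pow, pow_eq_zero_iff] at h0
  funext q
  rw [show q = (0, 0) from Subsingleton.elim _ _, h0, Pi.zero_apply]

/-- **Initial-form nondegenerate of order `4` at the origin** (`γ = 1`, gradient `2`). -/
theorem sqSystem_initNondegAt_four : sqSystem.InitNondegAt 4 0 := by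
  classical
  refine ⟨fun _ => 4, fun _ => (X (0, 0)) ^ 2, fun _ => 1, fun _ => le_rfl, sqSystem_initialForm, ?_⟩
  -- the gradient matrix is the constant `2` on `Fin 1 × (Fin 1 × Fin 1)`
  have hG : gradMatrix (n := 1) (T := sqSystem.tests.length) (fun _ => 1)
      (fun _ => (X (0, 0) : MvPolynomial (Fin 1 × Fin 1) ℂ) ^ 2) =
      Matrix.of fun _ _ => (2 : ℂ) := by
    ext o q
    have hq : q = (0, 0) := Subsingleton.elim _ _
    subst hq
    simp only [gradMatrix, Matrix.of_apply]
    rw [sq, Derivation.leibniz]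
    simp [pderiv_X]
    norm_num
  rw [hG]
  -- reindex to a `1 × 1` matrix and use invertibility
  have hT : sqSystem.tests.length = 1 := rfl
  let em : Fin sqSystem.tests.length ≃ Unit := (finCongr hT).trans (Fintype.equivOfCardEq rfl)
  let en : (Fin 1 × Fin 1) ≃ Unit := Fintype.equivOfCardEq rfl
  have hre : (Matrix.reindex em en (Matrix.of fun (_ : Fin sqSystem.tests.length)
      (_ : Fin 1 × Fin 1) => (2 : ℂ))) = Matrix.of fun (_ : Unit) (_ : Unit) => (2 : ℂ) := by
    ext i j; rfl
  have hrank := Matrix.rank_reindex em en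
    (Matrix.of fun (_ : Fin sqSystem.tests.length) (_ : Fin 1 × Fin 1) => (2 : ℂ))
  rw [hre] at hrank
  rw [← hrank]
  have hU : IsUnit (Matrix.of fun (_ : Unit) (_ : Unit) => (2 : ℂ)) := by
    rw [Matrix.isUnit_iff_isUnit_det, Matrix.det_unique]
    exact isUnit_iff_ne_zero.mpr two_ne_zero
  rw [Matrix.rank_of_isUnit _ hU]
  simp

/-! ## Strictness of the per-system hypotheses, by example -/

/-- **There is a correct system which is pure isolated (order `4`) but NOT generically reduced.** -/
theorem exists_correct_pureIsolated_not_reduced :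
    ∃ E : EqSystem 1, E.Correct ∧ E.PureIsolated 4 ∧ ¬ E.GenericallyReduced :=
  ⟨sqSystem, sqSystem_correct, ⟨0, zero_mem_mmGraph 1, sqSystem_pureIsolatedAt_four⟩,
    sqSystem_not_genericallyReduced⟩

/-- **There is a correct system which is initial-form nondegenerate (order `4`) but NOT generically
reduced.** -/
theorem exists_correct_initNondeg_not_reduced :
    ∃ E : EqSystem 1, E.Correct ∧ E.InitNondeg 4 ∧ ¬ E.GenericallyReduced :=
  ⟨sqSystem, sqSystem_correct, ⟨0, zero_mem_mmGraph 1, sqSystem_initNondegAt_four⟩,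
    sqSystem_not_genericallyReduced⟩

end Summit.MatrixMultiplication.MatrixMultiplication.Theorems.GraphEquations

end
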